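import Literature.MathematicalPhysics.QuantumLattice.InfVolFermionState
import Literature.MathematicalPhysics.QuantumLattice.FermionOperatorsProofs
import HarnessLib

/-!
# Smeared field operators, the one-body Pauli bound `0 ≤ ω(a†(f) a(f)) ≤ ‖f‖²`, and the
# translation-invariant two-point function of a lattice fermion state

Topic `Literature/MathematicalPhysics/QuantumLattice` (family `hubbard`). For a finite family of
distinct sites `x_i ∈ Λ ⊂ ℤ^d`, a spin `σ` and coefficients `f_i ∈ ℂ`, the **smeared annihilation
operator** `a(f) = Σ_i f_i c_{x_i σ} ∈ 𝔄_Λ` satisfies the CAR norm identity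
`a(f) a(f)† + a(f)† a(f) = (Σ_i |f_i|²)·𝟙` (Bratteli–Robinson II §5.2.2, eqs. (5.2.11)–(5.2.13):
`{a(f), a†(g)} = ⟨f, g⟩ 𝟙`), hence for EVERY state `ω` of the CAR algebra
`0 ≤ ω(a(f)† a(f)) ≤ Σ_i |f_i|²` — the one-body **Pauli bound** `0 ≤ γ_ω ≤ 𝟙` on the one-particle
density matrix `γ_ω(g, f) = ω(a†(f) a(g))` (Lieb–Seiringer, *The Stability of Matter in Quantum
Mechanics*, Thm. 3.2, eq. (3.1.35): the admissible fermionic one-body density matrices are exactly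
`0 ≤ γ ≤ 𝟙`; here only the easy necessity direction, for arbitrary — not necessarily
`N`-particle — states). We also record the **two-point function**
`G_ω(x, y) = ω(c†_{xσ} c_{yσ})` of an infinite-volume state (`InfVolFermionState`, computed in any
region containing `x, y`) and its covariance `G_ω(x + w, y + w) = G_ω(x, y)` for translation-invariant
`ω` (Araki–Moriya 2003 §4.1, eq. (4.12)). Everything is PROVED (finite-dimensional matrix algebra in
the tree's Jordan–Wigner model); the file introduces no definition of a new notion beyond the two
abbreviations `smearedAnnihilation`, `InfVolFermionState.twoPoint`, and no named fact.

These are the two inputs of the cell's Pauli–Markov one-body cut (Ventures/CertifiedManyBodySolver,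
`Transport/PauliMarkov.lean`): positivity of the Fejér-smeared momentum density and its bound by `1`.

## References
* E. H. Lieb, R. Seiringer, *The Stability of Matter in Quantum Mechanics* (Cambridge UP 2010),
  §3.1.4, Thm. 3.2 and eq. (3.1.35) (`γ ≤ 𝟙` for fermions; PDF p. 46). [cite: LiebSeiringer2009, Thm. 3.2 eq. (3.1.35)]
* O. Bratteli, D. W. Robinson, *Operator Algebras and Quantum Statistical Mechanics II*, 2nd ed.
  (Springer 1997), §5.2.2, eqs. (5.2.11)–(5.2.13) (CAR, `‖a(f)‖ = ‖f‖`). [cite: BratteliRobinsonII1997, §5.2.2 (5.2.11)–(5.2.13)]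
* H. Araki, H. Moriya, *Equilibrium statistical mechanics of fermion lattice systems*,
  Rev. Math. Phys. 15 (2003) 93–198, §4.1 eq. (4.12) (translation covariance). [cite: ArakiMoriya2003, §4.1 eq. (4.12)]
-/

noncomputable section

namespace Literature.MathematicalPhysics.QuantumLattice

open Matrix Finset HubbardWave0 Literature.Probability.LatticeModels
open scoped ComplexOrder

variable {d : ℕ}

/-! ### §1. Smeared annihilation operators and the CAR norm identity -/

section Smear

variable {Λ : Finset (Site d)} {ι : Type*} [Fintype ι]

/-- **The smeared annihilation operator** `a(f) = Σ_i f_i c_{x_i σ} ∈ 𝔄_Λ` of a finite family of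
sites `x_i ∈ Λ` with coefficients `f_i` (one spin component `σ`). Bratteli–Robinson II §5.2.2
(`a(f)` antilinear in `f`; here the coefficient vector is used directly).
[cite: BratteliRobinsonII1997, §5.2.2 (5.2.11)–(5.2.13)] -/
def smearedAnnihilation (x : ι → Site d) (hx : ∀ i, x i ∈ Λ) (σ : Fin 2) (f : ι → ℂ) : FermionOp Λ :=
  ∑ i, f i • cAt (x i) (hx i) σ

/-- `a(f) = Σ_i f_i c_{x_iσ}` unfolded. [cite: BratteliRobinsonII1997, §5.2.2 (5.2.11)–(5.2.13)] -/
theorem smearedAnnihilation_eq (x : ι → Site d) (hx : ∀ i, x i ∈ Λ) (σ : Fin 2) (f : ι → ℂ) :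
    smearedAnnihilation x hx σ f = ∑ i, f i • cAt (x i) (hx i) σ := rfl

/-- `a(f)† = Σ_i f̄_i c†_{x_i σ}`. [cite: BratteliRobinsonII1997, §5.2.2] -/
theorem smearedAnnihilation_conjTranspose (x : ι → Site d) (hx : ∀ i, x i ∈ Λ) (σ : Fin 2) (f : ι → ℂ) :
    (smearedAnnihilation x hx σ f)ᴴ = ∑ i, star (f i) • (cAt (x i) (hx i) σ)ᴴ := by
  simp [smearedAnnihilation, Matrix.conjTranspose_sum, Matrix.conjTranspose_smul]

omit [Fintype ι] in
/-- Distinct sites carry distinct orbitals: `(x_i, σ) = (x_j, σ)` in `Orb (PolySite Λ)` iff `i = j`,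
for an injective family of sites. [folklore] -/
private theorem orb_pt_eq_iff {x : ι → Site d} (hxi : Function.Injective x) (hx : ∀ i, x i ∈ Λ) (σ : Fin 2)
    (i j : ι) : orb (PolySite.pt (x i) (hx i)) σ = orb (PolySite.pt (x j) (hx j)) σ ↔ i = j := by
  constructor
  · intro h
    have h1 := (orb_eq_orb_iff.1 h).1
    have h2 : x i = x j := by
      have := congrArg (fun p : PolySite Λ => ofLex p.1) h1
      simpa using this
    exact hxi h2
  · rintro rfl
    rfl

/-- **The CAR norm identity for smeared operators**: for distinct sites,
`a(f) a(f)† + a(f)† a(f) = (Σ_i |f_i|²) 𝟙` (from `{c_{x_iσ}, c†_{x_jσ}} = δ_{ij} 𝟙`).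
Bratteli–Robinson II §5.2.2, (5.2.11)–(5.2.13). [cite: BratteliRobinsonII1997, §5.2.2 (5.2.12)] -/
theorem smearedAnnihilation_mul_conjTranspose_add {x : ι → Site d} (hxi : Function.Injective x)
    (hx : ∀ i, x i ∈ Λ) (σ : Fin 2) (f : ι → ℂ) :
    smearedAnnihilation x hx σ f * (smearedAnnihilation x hx σ f)ᴴ +
        (smearedAnnihilation x hx σ f)ᴴ * smearedAnnihilation x hx σ f =
      ((∑ i, ‖f i‖ ^ 2 : ℝ) : ℂ) • (1 : FermionOp Λ) := by
  classical
  rw [smearedAnnihilation_conjTranspose, smearedAnnihilation_eq]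
  -- expand both products as double sums over `(i, j)`
  have h1 : (∑ i, f i • cAt (x i) (hx i) σ) * (∑ j, star (f j) • (cAt (x j) (hx j) σ)ᴴ) =
      ∑ i, ∑ j, (f i * star (f j)) • (cAt (x i) (hx i) σ * (cAt (x j) (hx j) σ)ᴴ) := by
    rw [Finset.sum_mul]
    refine Finset.sum_congr rfl fun i _ => ?_
    rw [Finset.mul_sum]
    refine Finset.sum_congr rfl fun j _ => ?_
    rw [Matrix.smul_mul, Matrix.mul_smul, smul_smul]
  have h2 : (∑ j, star (f j) • (cAt (x j) (hx j) σ)ᴴ) * (∑ i, f i • cAt (x i) (hx i) σ) =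
      ∑ i, ∑ j, (f i * star (f j)) • ((cAt (x j) (hx j) σ)ᴴ * cAt (x i) (hx i) σ) := by
    rw [Finset.sum_mul, Finset.sum_comm]
    refine Finset.sum_congr rfl fun i _ => ?_
    rw [Finset.mul_sum]
    refine Finset.sum_congr rfl fun j _ => ?_
    rw [Matrix.smul_mul, Matrix.mul_smul, smul_smul, mul_comm]
  rw [h1, h2, ← Finset.sum_add_distrib]
  simp_rw [← Finset.sum_add_distrib, ← smul_add]
  -- the anticommutator `c_i c†_j + c†_j c_i = δ_ij`
  have hCAR : ∀ i j, cAt (x i) (hx i) σ * (cAt (x j) (hx j) σ)ᴴ + (cAt (x j) (hx j) σ)ᴴ * cAt (x i) (hx i) σ =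
      if i = j then (1 : FermionOp Λ) else 0 := by
    intro i j
    rw [cAt, cAt, annihilation_conjTranspose,
      annihilation_mul_creation_add_creation_mul_annihilation_holds]
    by_cases hij : i = j
    · subst hij; simp
    · rw [if_neg (fun h => hij ((orb_pt_eq_iff hxi hx σ i j).1 h)), if_neg hij]
  simp_rw [hCAR, smul_ite, smul_zero, Finset.sum_ite_eq, Finset.mem_univ, if_true]
  rw [← Finset.sum_smul]
  congr 1
  push_cast
  refine Finset.sum_congr rfl fun i _ => ?_
  rw [Complex.star_def, Complex.mul_conj, Complex.normSq_eq_norm_sq]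
  push_cast
  ring

end Smear

/-! ### §2. The one-body Pauli bound `0 ≤ ω(a(f)† a(f)) ≤ Σ |f_i|²` -/

section Pauli

variable {Λ : Finset (Site d)} {ι : Type*} [Fintype ι]

namespace InfVolFermionState

/-- Positivity: `0 ≤ ω(a(f)† a(f))` (in `ℂ` with the `ComplexOrder`). [cite: LiebSeiringer2009, Thm. 3.2 eq. (3.1.35)] -/
theorem expect_smeared_nonneg (ω : InfVolFermionState d) (x : ι → Site d) (hx : ∀ i, x i ∈ Λ)
    (σ : Fin 2) (f : ι → ℂ) :
    0 ≤ ω.expect Λ ((smearedAnnihilation x hx σ f)ᴴ * smearedAnnihilation x hx σ f) :=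
  ω.expect_nonneg Λ _

/-- **Pauli bound** (necessity half of Lieb–Seiringer Thm. 3.2, for an arbitrary state of the CAR
algebra): `ω(a(f)† a(f)) + ω(a(f) a(f)†) = Σ_i |f_i|²` with both terms `≥ 0`, hence
`Re ω(a(f)† a(f)) ≤ Σ_i |f_i|²`. [cite: LiebSeiringer2009, Thm. 3.2 eq. (3.1.35)] -/
theorem re_expect_smeared_le (ω : InfVolFermionState d) {x : ι → Site d} (hxi : Function.Injective x)
    (hx : ∀ i, x i ∈ Λ) (σ : Fin 2) (f : ι → ℂ) :
    (ω.expect Λ ((smearedAnnihilation x hx σ f)ᴴ * smearedAnnihilation x hx σ f)).re ≤ ∑ i, ‖f i‖ ^ 2 := by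
  set A := smearedAnnihilation x hx σ f with hA
  have hsum : ω.expect Λ (A * Aᴴ) + ω.expect Λ (Aᴴ * A) = ((∑ i, ‖f i‖ ^ 2 : ℝ) : ℂ) := by
    rw [← map_add, smearedAnnihilation_mul_conjTranspose_add hxi hx σ f, map_smul, ω.expect_one,
      smul_eq_mul, mul_one]
  have hpos : 0 ≤ ω.expect Λ (A * Aᴴ) := by
    have := ω.expect_nonneg Λ Aᴴ
    rwa [Matrix.conjTranspose_conjTranspose] at this
  have hre := congrArg Complex.re hsum
  rw [Complex.add_re, Complex.ofReal_re] at hre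
  have h0 : 0 ≤ (ω.expect Λ (A * Aᴴ)).re := (Complex.nonneg_iff.1 hpos).1
  linarith

/-- The Pauli bound, two-sided, on the real part. [cite: LiebSeiringer2009, Thm. 3.2 eq. (3.1.35)] -/
theorem re_expect_smeared_mem_Icc (ω : InfVolFermionState d) {x : ι → Site d} (hxi : Function.Injective x)
    (hx : ∀ i, x i ∈ Λ) (σ : Fin 2) (f : ι → ℂ) :
    (ω.expect Λ ((smearedAnnihilation x hx σ f)ᴴ * smearedAnnihilation x hx σ f)).re ∈
      Set.Icc 0 (∑ i, ‖f i‖ ^ 2) :=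
  ⟨(Complex.nonneg_iff.1 (ω.expect_smeared_nonneg x hx σ f)).1, ω.re_expect_smeared_le hxi hx σ f⟩

/-- `ω(a(f)† a(f))` is real (it is `≥ 0`). [cite: LiebSeiringer2009, Thm. 3.2 eq. (3.1.35)] -/
theorem im_expect_smeared_eq_zero (ω : InfVolFermionState d) (x : ι → Site d) (hx : ∀ i, x i ∈ Λ)
    (σ : Fin 2) (f : ι → ℂ) :
    (ω.expect Λ ((smearedAnnihilation x hx σ f)ᴴ * smearedAnnihilation x hx σ f)).im = 0 :=
  (Complex.nonneg_iff.1 (ω.expect_smeared_nonneg x hx σ f)).2.symm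

/-- **`ω(a(f)† a(f))` as a quadratic form in the two-point function**:
`ω(a(f)† a(f)) = Σ_{i,j} f̄_i f_j ω(c†_{x_iσ} c_{x_jσ})`. [cite: BratteliRobinsonII1997, §5.2.2] -/
theorem expect_smeared_eq_sum (ω : InfVolFermionState d) (x : ι → Site d) (hx : ∀ i, x i ∈ Λ)
    (σ : Fin 2) (f : ι → ℂ) :
    ω.expect Λ ((smearedAnnihilation x hx σ f)ᴴ * smearedAnnihilation x hx σ f) =
      ∑ i, ∑ j, star (f i) * f j * ω.expect Λ ((cAt (x i) (hx i) σ)ᴴ * cAt (x j) (hx j) σ) := by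
  rw [smearedAnnihilation_conjTranspose, smearedAnnihilation_eq, Finset.sum_mul, map_sum]
  refine Finset.sum_congr rfl fun i _ => ?_
  rw [Finset.mul_sum, map_sum]
  refine Finset.sum_congr rfl fun j _ => ?_
  rw [Matrix.smul_mul, Matrix.mul_smul, smul_smul, map_smul, smul_eq_mul]

end InfVolFermionState

end Pauli

/-! ### §3. The two-point function `G_ω(x, y) = ω(c†_{xσ} c_{yσ})` and translation covariance -/

section TwoPoint

namespace InfVolFermionState

/-- **The two-point function** `G_ω^σ(x, y) = ω(c†_{xσ} c_{yσ})` of an infinite-volume state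
(the one-particle density matrix in the site basis), computed on the region `{x} ∪ {y}`.
[cite: ArakiMoriya2003, §4.1 Def. 4.1 (2)] -/
def twoPoint (ω : InfVolFermionState d) (σ : Fin 2) (x y : Site d) : ℂ :=
  ω.corr ((cAt x (Finset.mem_singleton_self x) σ)ᴴ) (cAt y (Finset.mem_singleton_self y) σ)

/-- The two-point function may be computed in ANY region containing both sites (isotony of the
local algebras). [cite: ArakiMoriya2003, §4.1 Def. 4.1 (2)] -/
theorem expect_creation_mul_annihilation (ω : InfVolFermionState d) (σ : Fin 2) {Λ : Finset (Site d)}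
    {x y : Site d} (hx : x ∈ Λ) (hy : y ∈ Λ) :
    ω.expect Λ ((cAt x hx σ)ᴴ * cAt y hy σ) = ω.twoPoint σ x y := by
  rw [twoPoint, ω.corr_eq_expect_of_subset (Finset.singleton_subset_iff.2 hx)
    (Finset.singleton_subset_iff.2 hy), fermionEmbed_conjTranspose, fermionEmbed_incl_cAt,
    fermionEmbed_incl_cAt]

/-- A `corr` of a creation and an annihilation operator living in two regions is the two-point
function. [cite: ArakiMoriya2003, §4.1 Def. 4.1 (2)] -/
theorem corr_creation_annihilation (ω : InfVolFermionState d) (σ : Fin 2) {Λ₁ Λ₂ : Finset (Site d)}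
    {x y : Site d} (hx : x ∈ Λ₁) (hy : y ∈ Λ₂) :
    ω.corr ((cAt x hx σ)ᴴ) (cAt y hy σ) = ω.twoPoint σ x y := by
  rw [corr_eq, fermionEmbed_conjTranspose, fermionEmbed_incl_cAt, fermionEmbed_incl_cAt,
    expect_creation_mul_annihilation]

/-- **Translation covariance of the two-point function**: for translation-invariant `ω`,
`G_ω(x + w, y + w) = G_ω(x, y)`. [cite: ArakiMoriya2003, §4.1 eq. (4.12)] -/
theorem IsTranslationInvariant.twoPoint_add (ω : InfVolFermionState d) (hω : ω.IsTranslationInvariant)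
    (σ : Fin 2) (x y w : Site d) : ω.twoPoint σ (x + w) (y + w) = ω.twoPoint σ x y := by
  conv_rhs => rw [twoPoint, ← hω w, shift_corr, fermionEmbed_conjTranspose, fermionEmbed_shiftEmb_cAt,
    fermionEmbed_shiftEmb_cAt, corr_creation_annihilation]

/-- Translation invariance in difference form: `G_ω(x, y) = G_ω(0, y - x)`. [cite: ArakiMoriya2003, §4.1 eq. (4.12)] -/
theorem IsTranslationInvariant.twoPoint_eq_zero_sub (ω : InfVolFermionState d)
    (hω : ω.IsTranslationInvariant) (σ : Fin 2) (x y : Site d) :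
    ω.twoPoint σ x y = ω.twoPoint σ 0 (y - x) := by
  rw [← hω.twoPoint_add ω σ x y (-x), add_neg_cancel, ← sub_eq_add_neg]

/-- `G_ω(x, x) = ω(n_{xσ})` is the occupation of the orbital `(x, σ)` (diagonal of the one-particle
density matrix). [cite: LiebSeiringer2009, §3.1.4 (one-particle density matrix)] -/
theorem expect_nAt_eq_twoPoint (ω : InfVolFermionState d) (σ : Fin 2) {Λ : Finset (Site d)} {x : Site d}
    (hx : x ∈ Λ) : ω.expect Λ (nAt x hx σ) = ω.twoPoint σ x x := by
  rw [← expect_creation_mul_annihilation ω σ hx hx]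
  rfl

/-- The two-point function is Hermitian: `conj G_ω(x, y) = G_ω(y, x)` (`γ` is self-adjoint).
[cite: LiebSeiringer2009, §3.1.4 (one-particle density matrix)] -/
theorem star_twoPoint (ω : InfVolFermionState d) (σ : Fin 2) (x y : Site d) :
    star (ω.twoPoint σ x y) = ω.twoPoint σ y x := by
  have hx : x ∈ ({x, y} : Finset (Site d)) := Finset.mem_insert_self _ _
  have hy : y ∈ ({x, y} : Finset (Site d)) := Finset.mem_insert_of_mem (Finset.mem_singleton_self _)
  rw [← expect_creation_mul_annihilation ω σ hx hy, ← expect_creation_mul_annihilation ω σ hy hx,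
    ← expect_conjTranspose, Matrix.conjTranspose_mul, Matrix.conjTranspose_conjTranspose]

/-- `|G_ω(x, x)| ≤ 1`: the occupation `ω(n_{xσ})` of an orbital lies in `[0, 1]` (Pauli bound on the
one-site smearing `a(f) = c_x`). [cite: LiebSeiringer2009, Thm. 3.2 eq. (3.1.35)] -/
theorem norm_twoPoint_self_le_one (ω : InfVolFermionState d) (σ : Fin 2) (x : Site d) :
    ‖ω.twoPoint σ x x‖ ≤ 1 := by
  -- one site: `a(f) = c_x`, `Σ |f|² = 1`
  have hxi : Function.Injective (fun _ : Unit => x) := fun a b _ => Subsingleton.elim a b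
  have hmem : ∀ _ : Unit, x ∈ ({x} : Finset (Site d)) := fun _ => Finset.mem_singleton_self x
  have h := ω.re_expect_smeared_mem_Icc hxi hmem σ (fun _ => 1)
  have him := ω.im_expect_smeared_eq_zero (fun _ : Unit => x) hmem σ (fun _ => 1)
  have hA : smearedAnnihilation (fun _ : Unit => x) hmem σ (fun _ => 1) = cAt x (Finset.mem_singleton_self x) σ := by
    simp [smearedAnnihilation]
  rw [hA, expect_creation_mul_annihilation] at h him
  simp only [Finset.univ_unique, norm_one, one_pow, Finset.sum_const, Finset.card_singleton,
    one_smul] at h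
  have hz : ω.twoPoint σ x x = ((ω.twoPoint σ x x).re : ℂ) :=
    Complex.ext (by simp) (by simp [him])
  rw [hz, Complex.norm_real, Real.norm_eq_abs, abs_of_nonneg h.1]
  exact h.2

end InfVolFermionState

end TwoPoint

end Literature.MathematicalPhysics.QuantumLattice

end
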